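import Literature.AlgebraicGeometry.Frobenioids.BaseFrobeniusSections
import Literature.AlgebraicGeometry.Frobenioids.PreFrobenioidDataOfFunctor
import Literature.AlgebraicGeometry.Frobenioids.DivisorMonoidCategoryTheoreticityDefs
import HarnessLib

/-!
# Frobenioids I, §5: Theorem 5.1 (Divisorial Descriptions), part (iv)

Mochizuki, *The geometry of Frobenioids I: the general theory*, Kyushu J. Math. **62** (2008)
293–400, §5, Theorem 5.1 (iv), kurims text p. 97 ll. 18–20 (statement), pp. 99 l. 47 – 100 l. 5
(proof) [cite: MochizukiFrdI2008, Thm. 5.1 (iv) p.97].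

**Text (p. 97).** "(iv) Suppose that `C` is of unit-trivial type. Then any skeletal subcategory
`P ⊆ (C^Fr-tr)^pl-bk` determines a base-section of `C`; any base-section of `C` admits an associated
Frobenius-section `F`. Moreover, `C` is of model type." Standing hypotheses of Theorem 5.1: `C → F_Φ`
a Frobenioid of isotropic type over a divisorial monoid `Φ` on a connected, totally epimorphic `D`.

**Vocabulary consumed (read-only).** Base-sections, Frobenius-sections, pre-model type = Def. 2.7
(i)–(iii) (`PreFrobenioid.Presection`, `IsBaseSection`, `IsFrobeniusSection`, `IsOfPreModelType`,
file `BaseFrobeniusSections.lean`, seat abc-iut-L1-t2); unit-trivial objects, pull-back morphisms,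
Frobenius-trivial objects = Def. 1.2 (seat abc-iut-found). *Model type* = Def. 4.5 (i) p. 86
("pre-model and birationally Frobenius-normalized type"): the "birationally Frobenius-normalized"
half is a §4 notion over the birationalization `C^birat` (seat abc-iut-L1-t3, interface
`PreFrobenioidData.BiratData`, no concrete declaration applicable to a functor `F : C ⥤ F_Φ` yet),
so the "Moreover" clause is typed TWICE: `Thm51iv_preModel` with the real Def. 2.7 (iii) predicate,
and `Thm51iv_modelType` binding "model type" BY NAME (W2-8 (3)) as pre-model AND birationally
Frobenius-normalized (`PreFrobenioidData.IsOfBiratFrobeniusNormalizedType B`, Def. 4.5 (i), file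
`DivisorMonoidCategoryTheoreticityDefs.lean`, seat abc-iut-L1-t3) over a birationalization datum `B` of
`C` — a data-only interface, so that declaration is a SCHEMA (W2-8 (5): faithful when `B` is THE
birationalization, `phiBirat = biratSubfunctor F`, RULING C5′). Nothing here defines "model type".

**READING recorded for the referee.** "`(C^Fr-tr)^pl-bk`" is read as: Frobenius-trivial objects
and the *pull-back morphisms of `C`* between them (pull-back morphisms are LB-invertible, hence
isometric, Def. 1.3 (iv)(b), so they lie in `C^Fr-tr`); this is the reading under which the printed
conclusion "`P` determines a base-section of `C`" (Def. 2.7 (i) requires `P ⊆ C^pl-bk`) parses, and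
it is how the proof (p. 99 ll. 49–55) uses the phrase ("any morphism `Base(A) → Base(B)` lifts to a
pull-back morphism of `C^Fr-tr`"). "Skeletal subcategory" = §0 p. 15: a full subcategory that is a
skeleton and whose inclusion is an equivalence (`IsSkeletalSubcatFrTrPlbk`). No statement is
strengthened; all three clauses are named `Prop` statements (proof ≈ 120 words, routine once
Thm. 5.1 (iii) is available — deep pool together with (i)–(iii)).
-/

namespace Literature.AlgebraicGeometry.Frobenioids

open CategoryTheory Opposite

universe w v v' u u'

namespace PreFrobenioid

variable {D : Type u} [Category.{v} D] {Φ : Dᵒᵖ ⥤ CommMonCat.{w}}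
  {C : Type u'} [Category.{v'} C] (F : C ⥤ ElemFrobenioid Φ)

/-- "`C` is of unit-trivial type" (Def. 1.2 (v)): every object is unit-trivial, `O^×(A) = {1}`.
[cite: MochizukiFrdI2008, Def. 1.2 (v) p.23] -/
abbrev IsOfUnitTrivialType : Prop := IsOfType (IsUnitTrivial F)

/-- "A skeletal subcategory `P ⊆ (C^Fr-tr)^pl-bk`" (Thm. 5.1 (iv) p. 97; §0 p. 15), for a subcategory
`P` of `C` given by object/arrow predicates (`Presection`, Def. 2.7): the objects of `P` are
Frobenius-trivial; `P` is FULL inside `(C^Fr-tr)^pl-bk`, i.e. its arrows are exactly the pull-back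
morphisms of `C` between its objects (READING: see the module docstring); `P` is a skeleton; and the
inclusion `P ↪ (C^Fr-tr)^pl-bk` is essentially surjective, i.e. every Frobenius-trivial object is
isomorphic to an object of `P`. [cite: MochizukiFrdI2008, Thm. 5.1 (iv) p.97] -/
structure IsSkeletalSubcatFrTrPlbk (P : Presection C) : Prop where
  /-- objects of `P` are Frobenius-trivial (objects of `C^Fr-tr`) -/
  obj_isFrobeniusTrivial : ∀ A : C, P.obj A → IsFrobeniusTrivial F A
  /-- `P` is the full subcategory of `(C^Fr-tr)^pl-bk` on its objects -/
  hom_iff : ∀ {A B : C} (f : A ⟶ B), P.hom f ↔ P.obj A ∧ P.obj B ∧ IsPullbackMorphism F f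
  /-- `P` is a skeleton -/
  isSkeleton : P.IsSkeleton
  /-- `P ↪ (C^Fr-tr)^pl-bk` is essentially surjective -/
  essSurj : ∀ A : C, IsFrobeniusTrivial F A → ∃ B : C, P.obj B ∧ Nonempty (A ≅ B)

/-- **Theorem 5.1 (iv)**, first clause (named statement): for `C` a Frobenioid of isotropic and
unit-trivial type, "any skeletal subcategory `P ⊆ (C^Fr-tr)^pl-bk` determines a base-section of `C`"
(Def. 2.7 (i)). [cite: MochizukiFrdI2008, Thm. 5.1 (iv) p.97] -/
def Thm51iv_baseSection : Prop :=
  IsFrobenioid F → IsOfIsotropicType F → IsOfUnitTrivialType F →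
    ∀ P : Presection C, IsSkeletalSubcatFrTrPlbk F P → IsBaseSection F P

/-- **Theorem 5.1 (iv)**, second clause (named statement): for `C` a Frobenioid of isotropic and
unit-trivial type, "any base-section of `C` admits an associated Frobenius-section `F`" (Def. 2.7
(ii): a `P`-Frobenius-section `N_{≥1} → End(P ↪ C)`). [cite: MochizukiFrdI2008, Thm. 5.1 (iv) p.97] -/
def Thm51iv_frobeniusSection : Prop :=
  IsFrobenioid F → IsOfIsotropicType F → IsOfUnitTrivialType F →
    ∀ P : Presection C, IsBaseSection F P → ∃ Fr : ℕ+ →* End P.ι, IsFrobeniusSection F P Fr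

/-- **Theorem 5.1 (iv)**, "Moreover, `C` is of model type" — its Def. 2.7 (iii) half (named
statement): `C` is of pre-model type, i.e. admits a base-Frobenius pair (this is what the first two
clauses combine to; model type = pre-model + birationally Frobenius-normalized, Def. 4.5 (i) p. 86).
[cite: MochizukiFrdI2008, Thm. 5.1 (iv) p.97] -/
def Thm51iv_preModel : Prop :=
  IsFrobenioid F → IsOfIsotropicType F → IsOfUnitTrivialType F → IsOfPreModelType F

/-- **Theorem 5.1 (iv)**, "Moreover, `C` is of model type" (named statement; SCHEMA in `B`): model type
(Def. 4.5 (i) p. 86) = pre-model (Def. 2.7 (iii), `IsOfPreModelType`) AND birationally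
Frobenius-normalized (`IsOfBiratFrobeniusNormalizedType B`) for a birationalization datum `B` of `C`. The
printed proof (p. 100 ll. 2–5): "since `C` is of unit-trivial type, it follows immediately from the
structure of an elementary Frobenioid [cf. … Proposition 4.4, (iii)] that `C` is of birationally
Frobenius-normalized type, hence also of model type". [cite: MochizukiFrdI2008, Thm. 5.1 (iv) p.97] -/
def Thm51iv_modelType (B : (PreFrobenioidData.ofFunctor Φ F).BiratData) : Prop :=
  IsFrobenioid F → IsOfIsotropicType F → IsOfUnitTrivialType F →
    IsOfPreModelType F ∧ PreFrobenioidData.IsOfBiratFrobeniusNormalizedType B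

/-- The two renderings of the "Moreover" clause are consistent: `Thm51iv_modelType` (for any
birationalization datum) implies `Thm51iv_preModel`. [cite: MochizukiFrdI2008, Def. 4.5 (i) p.86] -/
theorem thm51iv_preModel_of_modelType {B : (PreFrobenioidData.ofFunctor Φ F).BiratData}
    (h : Thm51iv_modelType F B) : Thm51iv_preModel F :=
  fun hF hI hU => (h hF hI hU).1

end PreFrobenioid

end Literature.AlgebraicGeometry.Frobenioids
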